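import Summits.ValiantsHypothesis.ValiantsHypothesis.Theorems.SymPencilPerFourHessianBlocks
import Mathlib.Algebra.Polynomial.Roots
import Mathlib.Algebra.CharZero.Infinite

/-!
# Route `SymPencil` — Hessian rank `≤ 5` on a singular subspace: the first minors
# (first brick of Task T1 of `Cruxes/SdcSuperquadratic/NEXT-RUNG-23.md`, towards `sdc(per_4) ≥ 25`;
# `--supports` stmt-ValiantsHypothesis-5674 `SdcSuperquadratic`)

The SWAPPED reading of the kernel package (`SymPencilIsotropicKernelSquaresSwap`,
`SymPencilSdcPerFourKernelPackage`) says that for every `y` in the kernel space `V` the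
`s²`-coefficient of `s ↦ per_4 (u + s y)` is a sum of `d` weighted squares of linear functionals of
the base point `u`, i.e. `rank (Hess per_4)(y) ≤ d`.  `SymPencilPerFourHessianBlocks` used the
`4 × 4` principal blocks (`d ≤ 3` forces all `2 × 2` subpermanents to vanish).  Here: the `6 × 6`
principal blocks.  For rows `{a, b}` and a column `m`, restricting `u` to the six cells
`{a, b}ᶜ × {m}ᶜ` the `s²`-coefficient is the pairing `vᵀ P₃(y) w` of the two free rows through the
symmetric zero-diagonal `3 × 3` matrix of the three `2 × 2` subpermanents of rows `a, b` of `y` that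
use column `m`; `det P₃ = 2 · (their product)`.  Hence (`prod_perm_col_eq_zero_of_sum_sq_swap`):

  `d ≤ 5`  ⇒  for all rows `a ≠ b` and every column `m`, the product of the three subpermanents
  `y_{am} y_{bc} + y_{ac} y_{bm}` (`c ≠ m`) vanishes,

and on a SUBSPACE with the swapped property one of the three factors vanishes identically
(`exists_perm_col_vanish_of_sum_sq_swap`; a product of polynomial functions vanishing on a
linear space has a factor vanishing on it — `forall_eq_zero_or_of_mul₃`, via `Polynomial.funext`
along lines).  This is the per-row-pair input "rank P^R ≤ 2 ⇒ every column has an isotropic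
partner" of the planned exclusion of the case `(r, dim V) = (9, 7)` at defects `4, 5`.

Honest framing: a lemma towards the next rung; nothing here changes `sdc(per_4) ≥ 23`, the crux
`SdcSuperquadratic` stays open, `VP ≠ VNP` is not moved. [folklore]
-/

noncomputable section

-- single-conjunct layout: Sub = Summit, duplicated namespace component intended
set_option linter.dupNamespace false

namespace Summit.ValiantsHypothesis.ValiantsHypothesis.Theorems.SymPencilPerFourHessianMinors

open Matrix MvPolynomial Finset Module Polynomial
open Literature.Computability.AlgebraicComplexity
open Literature.Computability.AlgebraicComplexity.AlperBogartVelasco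
open Summit.ValiantsHypothesis.ValiantsHypothesis.Theorems.SymPencilPerFourBlocks
open Summit.ValiantsHypothesis.ValiantsHypothesis.Theorems.SymPencilPerFourHessianBlocks

variable {K : Type*} [Field K]

/-! ### Products of polynomial functions vanishing on a subspace -/

/-- Two functions which are polynomial along lines and do not vanish identically on a subspace
`W` are simultaneously non-zero at some point of `W` (infinite field). [folklore] -/
theorem exists_ne_zero_and_ne_zero [Infinite K] {M : Type*} [AddCommGroup M] [Module K M]
    (W : Submodule K M) {f g : M → K}
    (hf : ∀ y₀ y : M, ∃ p : K[X], ∀ t : K, f (y₀ + t • y) = p.eval t)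
    (hg : ∀ y₀ y : M, ∃ p : K[X], ∀ t : K, g (y₀ + t • y) = p.eval t)
    {y₁ y₂ : M} (h₁ : y₁ ∈ W) (h₂ : y₂ ∈ W) (hf₁ : f y₁ ≠ 0) (hg₂ : g y₂ ≠ 0) :
    ∃ y ∈ W, f y ≠ 0 ∧ g y ≠ 0 := by
  obtain ⟨p, hp⟩ := hf y₁ (y₂ - y₁)
  obtain ⟨q, hq⟩ := hg y₁ (y₂ - y₁)
  have hp0 : p ≠ 0 := fun h => hf₁ (by
    have := hp 0
    rw [zero_smul, add_zero, h, Polynomial.eval_zero] at this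
    exact this)
  have hq0 : q ≠ 0 := fun h => hg₂ (by
    have := hq 1
    rw [one_smul, add_sub_cancel, h, Polynomial.eval_zero] at this
    exact this)
  have hpq : p * q ≠ 0 := mul_ne_zero hp0 hq0
  by_contra hne
  push Not at hne
  apply hpq
  refine Polynomial.funext fun t => ?_
  rw [Polynomial.eval_mul, Polynomial.eval_zero]
  have hy : y₁ + t • (y₂ - y₁) ∈ W := W.add_mem h₁ (W.smul_mem t (W.sub_mem h₂ h₁))
  by_cases hft : f (y₁ + t • (y₂ - y₁)) = 0
  · rw [← hp t, hft, zero_mul]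
  · rw [← hq t, hne _ hy (by rwa [hp t] at hft ⊢), mul_zero]

/-- If a product of three functions, each polynomial along lines, vanishes on a subspace `W`
(infinite field), then one factor vanishes identically on `W`. [folklore] -/
theorem forall_eq_zero_or_of_mul₃ [Infinite K] {M : Type*} [AddCommGroup M] [Module K M]
    (W : Submodule K M) {f g h : M → K}
    (hf : ∀ y₀ y : M, ∃ p : K[X], ∀ t : K, f (y₀ + t • y) = p.eval t)
    (hg : ∀ y₀ y : M, ∃ p : K[X], ∀ t : K, g (y₀ + t • y) = p.eval t)
    (hh : ∀ y₀ y : M, ∃ p : K[X], ∀ t : K, h (y₀ + t • y) = p.eval t)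
    (H : ∀ y ∈ W, f y * g y * h y = 0) :
    (∀ y ∈ W, f y = 0) ∨ (∀ y ∈ W, g y = 0) ∨ (∀ y ∈ W, h y = 0) := by
  by_contra hne
  push Not at hne
  obtain ⟨⟨y₁, hy₁, hf₁⟩, ⟨y₂, hy₂, hg₂⟩, ⟨y₃, hy₃, hh₃⟩⟩ := hne
  obtain ⟨y₁₂, hy₁₂, hf', hg'⟩ := exists_ne_zero_and_ne_zero W hf hg hy₁ hy₂ hf₁ hg₂
  have hfg : ∀ y₀ y : M, ∃ p : K[X], ∀ t : K, (fun z => f z * g z) (y₀ + t • y) = p.eval t := by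
    intro y₀ y
    obtain ⟨p, hp⟩ := hf y₀ y
    obtain ⟨q, hq⟩ := hg y₀ y
    exact ⟨p * q, fun t => by rw [Polynomial.eval_mul, ← hp t, ← hq t]⟩
  obtain ⟨y, hy, hfg', hh'⟩ :=
    exists_ne_zero_and_ne_zero W (f := fun z => f z * g z) hfg hh hy₁₂ hy₃
      (mul_ne_zero hf' hg') hh₃
  exact mul_ne_zero hfg' hh' (H y hy)

/-- A `2 × 2` subpermanent is polynomial along lines (explicitly quadratic). [folklore] -/
theorem linePoly_perm_two (i j k l : Fin 4 × Fin 4) (y₀ y : Fin 4 × Fin 4 → K) :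
    ∃ p : K[X], ∀ t : K,
      (fun z : Fin 4 × Fin 4 → K => z i * z j + z k * z l) (y₀ + t • y) = p.eval t := by
  refine ⟨Polynomial.C (y₀ i * y₀ j + y₀ k * y₀ l) +
      Polynomial.C (y₀ i * y j + y i * y₀ j + y₀ k * y l + y k * y₀ l) * Polynomial.X +
      Polynomial.C (y i * y j + y k * y l) * Polynomial.X ^ 2, fun t => ?_⟩
  simp only [Pi.add_apply, Pi.smul_apply, smul_eq_mul, Polynomial.eval_add, Polynomial.eval_mul,
    Polynomial.eval_C, Polynomial.eval_X, Polynomial.eval_pow]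
  ring

/-! ### The `6 × 6` principal blocks of the Hessian -/

/-- `succAbove` on `Fin 4`, rows `0` and `1`. [folklore] -/
theorem succAbove_fin_four_zero_one :
    (0 : Fin 4).succAbove 0 = 1 ∧ (0 : Fin 4).succAbove 1 = 2 ∧ (0 : Fin 4).succAbove 2 = 3 ∧
    (1 : Fin 4).succAbove 0 = 0 ∧ (1 : Fin 4).succAbove 1 = 2 ∧ (1 : Fin 4).succAbove 2 = 3 := by
  decide

/-- **`per_4 (u + s y)` for `u` supported on the six cells `{2,3} × {0,1,2}`** (`u_{2j} = v_j`,
`u_{3j} = w_j`): the `s²`-coefficient is the pairing of `v` and `w` through the three `2 × 2`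
subpermanents of rows `0, 1` of `y` that use column `3`. [folklore] -/
theorem eval_perPoly_sixCells_add_smul (v w : Fin 3 → K) (y : Fin 4 × Fin 4 → K) :
    ∃ c₃ c₄ : K, ∀ s : K,
      eval ((fun p : Fin 4 × Fin 4 =>
          if p = (2, 0) then v 0 else if p = (2, 1) then v 1 else if p = (2, 2) then v 2
          else if p = (3, 0) then w 0 else if p = (3, 1) then w 1 else if p = (3, 2) then w 2
          else 0) + s • y) (perPoly (Fin 4) K) =
        s ^ 2 * ((v 0 * w 1 + v 1 * w 0) * (y (0, 2) * y (1, 3) + y (0, 3) * y (1, 2)) +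
                 (v 0 * w 2 + v 2 * w 0) * (y (0, 1) * y (1, 3) + y (0, 3) * y (1, 1)) +
                 (v 1 * w 2 + v 2 * w 1) * (y (0, 0) * y (1, 3) + y (0, 3) * y (1, 0))) +
          s ^ 3 * c₃ + s ^ 4 * c₄ := by
  obtain ⟨e20, e21, e22, e30, e31, e32⟩ := (succAbove_fin_four : _ ∧ _)
  obtain ⟨e00, e01, e02, e10, e11, e12⟩ := (succAbove_fin_four_zero_one : _ ∧ _)
  refine ⟨v 0 * ((Matrix.of fun i j => y (i, j)).submatrix (2 : Fin 4).succAbove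
        (0 : Fin 4).succAbove).permanent +
      v 1 * ((Matrix.of fun i j => y (i, j)).submatrix (2 : Fin 4).succAbove
        (1 : Fin 4).succAbove).permanent +
      v 2 * ((Matrix.of fun i j => y (i, j)).submatrix (2 : Fin 4).succAbove
        (2 : Fin 4).succAbove).permanent +
      w 0 * ((Matrix.of fun i j => y (i, j)).submatrix (3 : Fin 4).succAbove
        (0 : Fin 4).succAbove).permanent +
      w 1 * ((Matrix.of fun i j => y (i, j)).submatrix (3 : Fin 4).succAbove
        (1 : Fin 4).succAbove).permanent +
      w 2 * ((Matrix.of fun i j => y (i, j)).submatrix (3 : Fin 4).succAbove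
        (2 : Fin 4).succAbove).permanent,
    (Matrix.of fun i j => y (i, j)).permanent, fun s => ?_⟩
  rw [eval_perPoly, Matrix.permanent_fin_four_row, Matrix.permanent_fin_four_row]
  simp only [Matrix.permanent_fin_three_row]
  simp only [Matrix.of_apply, Matrix.submatrix_apply, Pi.add_apply, Pi.smul_apply, smul_eq_mul,
    e20, e21, e22, e30, e31, e32, e00, e01, e02, e10, e11, e12, Prod.mk.injEq]
  simp only [show ((0 : Fin 4) = 2) = False by decide, show ((1 : Fin 4) = 2) = False by decide,
    show ((3 : Fin 4) = 2) = False by decide, show ((0 : Fin 4) = 3) = False by decide,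
    show ((1 : Fin 4) = 3) = False by decide, show ((2 : Fin 4) = 3) = False by decide,
    show ((1 : Fin 4) = 0) = False by decide, show ((2 : Fin 4) = 0) = False by decide,
    show ((3 : Fin 4) = 0) = False by decide, show ((0 : Fin 4) = 1) = False by decide,
    show ((2 : Fin 4) = 1) = False by decide, show ((3 : Fin 4) = 1) = False by decide,
    and_false, and_true, if_false, if_true, and_self]
  ring

/-- The `3 × 3` symmetric zero-diagonal pairing has trivial kernel when the product of its three
entries is non-zero (characteristic `≠ 2`). [folklore] -/
theorem eq_zero_of_pairing₃ [CharZero K] {Q₀₁ Q₀₂ Q₁₂ : K} (hQ : Q₀₁ * Q₀₂ * Q₁₂ ≠ 0)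
    {z₀ z₁ z₂ : K} (h₀ : Q₀₁ * z₁ + Q₀₂ * z₂ = 0) (h₁ : Q₀₁ * z₀ + Q₁₂ * z₂ = 0)
    (h₂ : Q₀₂ * z₀ + Q₁₂ * z₁ = 0) : z₀ = 0 ∧ z₁ = 0 ∧ z₂ = 0 := by
  have h01 : Q₀₁ ≠ 0 := fun h => hQ (by rw [h]; ring)
  have h02 : Q₀₂ ≠ 0 := fun h => hQ (by rw [h]; ring)
  have h12 : Q₁₂ ≠ 0 := fun h => hQ (by rw [h]; ring)
  have hz₂ : (2 * (Q₀₂ * Q₁₂)) * z₂ = 0 := by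
    linear_combination Q₁₂ * h₀ - Q₀₁ * h₂ + Q₀₂ * h₁
  have z2 : z₂ = 0 :=
    (mul_eq_zero.1 hz₂).resolve_left (mul_ne_zero two_ne_zero (mul_ne_zero h02 h12))
  have z1 : z₁ = 0 := by
    have : Q₀₁ * z₁ = 0 := by rw [z2, mul_zero, add_zero] at h₀; exact h₀
    exact (mul_eq_zero.1 this).resolve_left h01
  have z0 : z₀ = 0 := by
    have : Q₀₁ * z₀ = 0 := by rw [z2, mul_zero, add_zero] at h₁; exact h₁
    exact (mul_eq_zero.1 this).resolve_left h01
  exact ⟨z0, z1, z2⟩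

/-- **The swapped hypothesis at `y` with `|ι| < 6` squares forces
`Q₀₁ Q₀₂ Q₁₂ = 0`** for the three `2 × 2` subpermanents of rows `0, 1` using column `3`. [folklore] -/
theorem prod_perm_zero_one_col_three_of_sum_sq_swap [CharZero K] {ι : Type*} [Fintype ι]
    (hι : Fintype.card ι < 6) (y : Fin 4 × Fin 4 → K) (c : ι → K)
    (Λ : ι → ((Fin 4 × Fin 4 → K) →ₗ[K] K))
    (h : ∀ u : Fin 4 × Fin 4 → K, ∃ e₀ e₁ : K, ∀ s : K,
      eval (u + s • y) (perPoly (Fin 4) K) = e₀ + s * e₁ + s ^ 2 * ∑ k, c k * (Λ k u) ^ 2) :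
    (y (0, 2) * y (1, 3) + y (0, 3) * y (1, 2)) * (y (0, 1) * y (1, 3) + y (0, 3) * y (1, 1)) *
      (y (0, 0) * y (1, 3) + y (0, 3) * y (1, 0)) = 0 := by
  classical
  set Q₀₁ := y (0, 2) * y (1, 3) + y (0, 3) * y (1, 2) with hQ₀₁
  set Q₀₂ := y (0, 1) * y (1, 3) + y (0, 3) * y (1, 1) with hQ₀₂
  set Q₁₂ := y (0, 0) * y (1, 3) + y (0, 3) * y (1, 0) with hQ₁₂
  -- the six-parameter family of base points, linear in `(v, w)`
  let U : (Fin 3 → K) × (Fin 3 → K) →ₗ[K] (Fin 4 × Fin 4 → K) :=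
    { toFun := fun vw p => if p = (2, 0) then vw.1 0 else if p = (2, 1) then vw.1 1
        else if p = (2, 2) then vw.1 2 else if p = (3, 0) then vw.2 0
        else if p = (3, 1) then vw.2 1 else if p = (3, 2) then vw.2 2 else 0
      map_add' := fun a b => by
        ext p
        simp only [Prod.fst_add, Prod.snd_add, Pi.add_apply]
        split_ifs <;> simp
      map_smul' := fun a vw => by
        ext p
        simp only [Prod.smul_fst, Prod.smul_snd, Pi.smul_apply, smul_eq_mul, RingHom.id_apply]
        split_ifs <;> simp }
  have hU : ∀ v w : Fin 3 → K, U (v, w) = fun p => if p = (2, 0) then v 0 else if p = (2, 1) then v 1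
      else if p = (2, 2) then v 2 else if p = (3, 0) then w 0 else if p = (3, 1) then w 1
      else if p = (3, 2) then w 2 else 0 := fun v w => rfl
  -- the `s²`-coefficient along the family is the pairing `F`
  set F : (Fin 3 → K) → (Fin 3 → K) → K := fun v w =>
    (v 0 * w 1 + v 1 * w 0) * Q₀₁ + (v 0 * w 2 + v 2 * w 0) * Q₀₂ + (v 1 * w 2 + v 2 * w 1) * Q₁₂
    with hF
  have hS : ∀ v w : Fin 3 → K, ∑ k, c k * (Λ k (U (v, w))) ^ 2 = F v w := by
    intro v w
    obtain ⟨e₀, e₁, he⟩ := h (U (v, w))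
    obtain ⟨c₃, c₄, hc⟩ := eval_perPoly_sixCells_add_smul v w y
    exact coeff_two_eq_of_forall fun s => by rw [← he s, hU, hc s]
  -- a common-kernel vector of the `Λ_k ∘ U` (six parameters, fewer than six functionals)
  let M : (Fin 3 → K) × (Fin 3 → K) →ₗ[K] (ι → K) := LinearMap.pi fun k => (Λ k).comp U
  have hM : ∀ vw k, M vw k = Λ k (U vw) := fun vw k => rfl
  have hker : LinearMap.ker M ≠ ⊥ := LinearMap.ker_ne_bot_of_finrank_lt (by
    rw [Module.finrank_fintype_fun_eq_card, Module.finrank_prod,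
      Module.finrank_fintype_fun_eq_card, Fintype.card_fin]
    omega)
  obtain ⟨n, hn, hn0⟩ := Submodule.exists_mem_ne_zero_of_ne_bot hker
  have hΛ0 : ∀ k, Λ k (U n) = 0 := fun k => by
    have := congr_fun (LinearMap.mem_ker.1 hn) k
    rwa [hM] at this
  -- translation invariance of `F` by `n = (v⁰, w⁰)`
  have hinv : ∀ v w : Fin 3 → K, F (n.1 + v) (n.2 + w) = F v w := by
    intro v w
    have h1 := hS (n.1 + v) (n.2 + w)
    have hadd : ((n.1 + v, n.2 + w) : (Fin 3 → K) × (Fin 3 → K)) = n + (v, w) := rfl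
    rw [hadd, map_add] at h1
    simp only [map_add, hΛ0, zero_add] at h1
    rw [hS v w] at h1
    exact h1.symm
  by_contra hQ
  -- the three linear equations for `w⁰` and for `v⁰`
  have E : ∀ v w : Fin 3 → K,
      (n.1 0 * w 1 + n.1 1 * w 0) * Q₀₁ + (n.1 0 * w 2 + n.1 2 * w 0) * Q₀₂ +
        (n.1 1 * w 2 + n.1 2 * w 1) * Q₁₂ +
      ((v 0 * n.2 1 + v 1 * n.2 0) * Q₀₁ + (v 0 * n.2 2 + v 2 * n.2 0) * Q₀₂ +
        (v 1 * n.2 2 + v 2 * n.2 1) * Q₁₂) +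
      ((n.1 0 * n.2 1 + n.1 1 * n.2 0) * Q₀₁ + (n.1 0 * n.2 2 + n.1 2 * n.2 0) * Q₀₂ +
        (n.1 1 * n.2 2 + n.1 2 * n.2 1) * Q₁₂) = 0 := by
    intro v w
    have := hinv v w
    simp only [hF, Pi.add_apply] at this
    linear_combination this
  have E00 := E 0 0
  have Ew0 := E (Pi.single 0 1) 0
  have Ew1 := E (Pi.single 1 1) 0
  have Ew2 := E (Pi.single 2 1) 0
  have Ev0 := E 0 (Pi.single 0 1)
  have Ev1 := E 0 (Pi.single 1 1)
  have Ev2 := E 0 (Pi.single 2 1)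
  simp only [Pi.zero_apply, Pi.single_apply] at E00 Ew0 Ew1 Ew2 Ev0 Ev1 Ev2
  simp only [show ((1 : Fin 3) = 0) = False by decide, show ((2 : Fin 3) = 0) = False by decide,
    show ((0 : Fin 3) = 1) = False by decide, show ((2 : Fin 3) = 1) = False by decide,
    show ((0 : Fin 3) = 2) = False by decide, show ((1 : Fin 3) = 2) = False by decide,
    if_true, if_false, mul_zero, zero_mul, mul_one, one_mul, zero_add, add_zero] at E00 Ew0 Ew1 Ew2 Ev0 Ev1 Ev2
  -- `P₃ w⁰ = 0`
  have hw : n.2 0 = 0 ∧ n.2 1 = 0 ∧ n.2 2 = 0 := by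
    refine eq_zero_of_pairing₃ hQ ?_ ?_ ?_
    · linear_combination Ew0 - E00
    · linear_combination Ew1 - E00
    · linear_combination Ew2 - E00
  -- `P₃ v⁰ = 0`
  have hv : n.1 0 = 0 ∧ n.1 1 = 0 ∧ n.1 2 = 0 := by
    refine eq_zero_of_pairing₃ hQ ?_ ?_ ?_
    · linear_combination Ev0 - E00
    · linear_combination Ev1 - E00
    · linear_combination Ev2 - E00
  apply hn0
  ext i <;> fin_cases i
  · exact hv.1
  · exact hv.2.1
  · exact hv.2.2
  · exact hw.1
  · exact hw.2.1
  · exact hw.2.2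

/-- **General rows and column.**  Under the swapped hypothesis at `y` (`|ι| < 6`), for rows
`a ≠ b` and a column `m`, the product of the three `2 × 2` subpermanents of rows `a, b` using
column `m` vanishes (the other columns enumerated as `(Equiv.swap 3 m) i`, `i = 0, 1, 2`).
[folklore] -/
theorem prod_perm_col_eq_zero_of_sum_sq_swap [CharZero K] {ι : Type*} [Fintype ι]
    (hι : Fintype.card ι < 6) (y : Fin 4 × Fin 4 → K)
    (h : ∃ (c : ι → K) (Λ : ι → ((Fin 4 × Fin 4 → K) →ₗ[K] K)),
      ∀ u : Fin 4 × Fin 4 → K, ∃ e₀ e₁ : K, ∀ s : K,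
        eval (u + s • y) (perPoly (Fin 4) K) = e₀ + s * e₁ + s ^ 2 * ∑ k, c k * (Λ k u) ^ 2)
    (a b m : Fin 4) (hab : a ≠ b) :
    (y (a, Equiv.swap 3 m 2) * y (b, m) + y (a, m) * y (b, Equiv.swap 3 m 2)) *
      (y (a, Equiv.swap 3 m 1) * y (b, m) + y (a, m) * y (b, Equiv.swap 3 m 1)) *
      (y (a, Equiv.swap 3 m 0) * y (b, m) + y (a, m) * y (b, Equiv.swap 3 m 0)) = 0 := by
  obtain ⟨c, Λ, hcΛ⟩ := h
  obtain ⟨σ, hσ0, hσ1⟩ := exists_perm_zero_one a b hab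
  set τ : Equiv.Perm (Fin 4) := Equiv.swap 3 m with hτ
  have hτ3 : τ 3 = m := by rw [hτ, Equiv.swap_apply_left]
  set e := Equiv.prodCongr σ τ with he
  -- the transported matrix `y' = y ∘ e` satisfies the swapped hypothesis with `Λ_k ∘ (· ∘ e⁻¹)`
  have h' : ∀ u : Fin 4 × Fin 4 → K, ∃ e₀ e₁ : K, ∀ s : K,
      eval (u + s • (y ∘ e)) (perPoly (Fin 4) K) =
        e₀ + s * e₁ + s ^ 2 * ∑ k, c k * ((Λ k).comp (LinearMap.funLeft K K e.symm) u) ^ 2 := by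
    intro u
    obtain ⟨e₀, e₁, hu⟩ := hcΛ (u ∘ e.symm)
    refine ⟨e₀, e₁, fun s => ?_⟩
    have hcomp : u + s • (y ∘ e) = (u ∘ e.symm + s • y) ∘ e := by
      ext p
      simp
    rw [hcomp, he, eval_perPoly_comp_prodCongr, ← he, hu s]
    rfl
  have h2 := prod_perm_zero_one_col_three_of_sum_sq_swap hι (y ∘ e) c
    (fun k => (Λ k).comp (LinearMap.funLeft K K e.symm)) h'
  simp only [Function.comp_apply, he, Equiv.prodCongr_apply, Prod.map_apply, hσ0, hσ1, hτ3] at h2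
  linear_combination h2

/-- **On a subspace: a column partner.**  If every `y ∈ W` has the swapped property with `|ι| < 6`
squares (i.e. `rank (Hess per_4)(y) ≤ 5` on `W`), then for all rows `a ≠ b` and every column `m`
there is a column `c ≠ m` such that the `2 × 2` subpermanent of rows `a, b` on columns `m, c`
vanishes identically on `W`. [folklore] -/
theorem exists_perm_col_vanish_of_sum_sq_swap [CharZero K] {ι : Type*} [Fintype ι]
    (hι : Fintype.card ι < 6) (W : Submodule K (Fin 4 × Fin 4 → K))
    (hW : ∀ y ∈ W, ∃ (c : ι → K) (Λ : ι → ((Fin 4 × Fin 4 → K) →ₗ[K] K)),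
      ∀ u : Fin 4 × Fin 4 → K, ∃ e₀ e₁ : K, ∀ s : K,
        eval (u + s • y) (perPoly (Fin 4) K) = e₀ + s * e₁ + s ^ 2 * ∑ k, c k * (Λ k u) ^ 2)
    (a b m : Fin 4) (hab : a ≠ b) :
    ∃ c : Fin 4, c ≠ m ∧ ∀ y ∈ W, y (a, c) * y (b, m) + y (a, m) * y (b, c) = 0 := by
  have hne : ∀ i : Fin 4, i ≠ 3 → Equiv.swap (3 : Fin 4) m i ≠ m := by
    intro i hi h
    by_cases him : i = m
    · rw [him, Equiv.swap_apply_right] at h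
      exact hi (him.trans h.symm)
    · rw [Equiv.swap_apply_of_ne_of_ne hi him] at h
      exact him h
  have H := forall_eq_zero_or_of_mul₃ W
    (linePoly_perm_two (a, Equiv.swap 3 m 2) (b, m) (a, m) (b, Equiv.swap 3 m 2))
    (linePoly_perm_two (a, Equiv.swap 3 m 1) (b, m) (a, m) (b, Equiv.swap 3 m 1))
    (linePoly_perm_two (a, Equiv.swap 3 m 0) (b, m) (a, m) (b, Equiv.swap 3 m 0))
    (fun y hy => prod_perm_col_eq_zero_of_sum_sq_swap hι y (hW y hy) a b m hab)
  rcases H with H | H | H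
  · exact ⟨_, hne 2 (by decide), H⟩
  · exact ⟨_, hne 1 (by decide), H⟩
  · exact ⟨_, hne 0 (by decide), H⟩

end Summit.ValiantsHypothesis.ValiantsHypothesis.Theorems.SymPencilPerFourHessianMinors

end
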